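import Summits.AtomisticToContinuum.Crystallization.Theorems.PalmUnimodularRigidityMinimiserShellsOfPeriodicShellGap
import Summits.AtomisticToContinuum.Crystallization.Theorems.PalmUnimodularRigidityMinimiserShellsMuGSCBasics
import Summits.AtomisticToContinuum.Crystallization.Theorems.PalmUnimodularRigidityMinimiserShellsNecessityBlocks
import Summits.AtomisticToContinuum.Crystallization.Theorems.PalmUnimodularRigidityMinimiserShellsResidualDefs
import Summits.AtomisticToContinuum.Crystallization.Theorems.PalmUnimodularRigidityMinimiserShellsSepReductionAssembly

/-!
# A.s. loosely good root shell (stub `stub_aeLooseGoodShell`, line `elastic-coarse-to-fine`, r5)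

Stub 4 `stub_aeLooseGoodShell` of line `elastic-coarse-to-fine` (skeleton r5) of crux `MinimiserShells`
(stmt-AtomisticToContinuum-9225, route `PalmUnimodularRigidity`, crux decl
`Summit.AtomisticToContinuum.Crystallization.Theses.PalmUnimodularRigidity.MinimiserShells`).

**Theorem (`stub_aeLooseGoodShell`).**  Let `θ ≥ 0`.  Assume
(1) the `θ`-loosely-good-shell event is measurable modulo the hard core: some measurable set `B` of
configurations agrees with `Residual.LooseGoodShell θ` on every rooted `δ`-hard-core counting measure, every
`δ > 0`; and
(2) the loosened hard-core finite no-boundary gap: for every `t > 0` some `κ > 0` makes every finite injective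
`1/3`-separated `y : Fin N → ℝ³` with at least `t·N` indices whose shell (read in `range y − y i`) is
`θ`-loosely bad satisfy `N·(e* + κ) ≤ 𝓔_N(y)`.
Then every minimising (`E_P[h] ≤ e*`) point-stationary `δ`-hard-core probability law `P` has almost surely a
`θ`-loosely good root shell.

Proof (the landed `θ = 0` chain S11 + S8b, `…ThresholdOfQualShellNoBoundary` and `…ThresholdTransfer`, run at
the loosened predicate and on the `1/3`-separated e*-DLR class).
* The a.s. class.  `EquilibriumInLaw.stub_equilibriumInLaw` (fed with `EnergyFloor.stub_energyFloor`) puts a.e.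
  configuration `μ = count|S` in the e*-`μ`GSC class; `μ` is also a.s. a rooted `δ`-hard-core counting measure
  `count|S₀`, and `S₀ = S` (a counting measure determines its carrier, `FccModel.set_eq_of_count_restrict_eq`),
  so `S` is uniformly discrete and the uniform hard core of e*-`μ`GSC (`VolumeGrowth.Basics.le_dist`) makes it
  `1/3`-separated.  We run the transfer with the class `K S := IsMuGSC V e* S ∧ S is 1/3-separated`.
* Threshold pricing on windows (S11 at the loose predicate, `thresholdPricing_of_sepLooseGap`).  For a window
  `C ⊆ S` of a `1/3`-separated `S` and deep sites `G ⊆ C` (`S ∩ B̄(y, 2) ⊆ C`) that are loosely badly shelled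
  in `S`, the canonical enumeration of `C` is injective and `1/3`-separated (`le_dist_equivFin`), a `2`-deep
  site is loosely bad in `S` iff it is loosely bad in `C` (locality of the loose predicate,
  `NecessityBlocks.looseGood_congr_of_local` / `congr_count_restrict_image_sub_of_local`), so `G` injects into
  the loosely-bad indices (`card_le_natCard_looseBad`) and hypothesis (2) gives
  `#G ≥ t·#C → #C·(e* + κ) ≤ ½ΣΣ_C V` (`two_mul_interactionEnergy_equivFin`).
* Transfer (S8b).  Threshold pricing is affine pricing `#C·e* + κ·#G ≤ ½ΣΣ_C V + κt·#C`
  (`ThresholdTransfer.affine_of_threshold`); the bad event `Bᶜ` read at a deep site `y ∈ G` of the window is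
  `¬ LooseGoodShell θ (count|((· − y) '' S))` by hypothesis (1) at the rooted hard-core measure
  `count|((· − y) '' S)`; the landed slack event transfer `SlackEventTransfer.stub_slackEventTransfer` bounds
  `P(Bᶜ) ≤ κt/κ = t` for every `t > 0`, hence `P(Bᶜ) = 0`, and by (1) again the root shell is a.s. loosely good.
-/

noncomputable section

open MeasureTheory ProbabilityTheory
open scoped ENNReal BigOperators Classical

namespace Summit.AtomisticToContinuum.Crystallization.Theorems.PalmUnimodularRigidityMinimiserShells.AeLooseGoodShell

open Literature.Probability.Process (IsPointStationaryLaw IsRootedHardCore count_restrict_singleton_ne_zero_iff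
  map_sub_count_restrict)
open Literature.MathematicalPhysics.StatisticalMechanics (lennardJones IsMuGSC UniformlyDiscrete interactionEnergy)
open Summit.AtomisticToContinuum.Crystallization.Theorems.MinimiserShells.Negative.LoadBearing
  (eStar meanRootEnergy GoodShell)
open Summit.AtomisticToContinuum.Crystallization.Theorems.MinimiserShells.Negative.Rootedness (E3)
open Summit.AtomisticToContinuum.Crystallization.Theorems.PalmUnimodularRigidityMinimiserShells.Residual (LooseGoodShell)
open Summit.AtomisticToContinuum.Crystallization.Theorems.PalmUnimodularRigidityMinimiserShells.EquilibriumInLaw.CellSums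
  (sep_image_sub)
open Summit.AtomisticToContinuum.Crystallization.Theorems.PalmUnimodularRigidityMinimiserShells.EquilibriumInLaw.Cluster
  (two_mul_interactionEnergy_equivFin)
open Summit.AtomisticToContinuum.Crystallization.Theorems.PalmUnimodularRigidityMinimiserShells.ShellNoBoundary
  (equivFin_symm_val_injective range_equivFin_symm_val)
open Summit.AtomisticToContinuum.Crystallization.Theorems.PalmUnimodularRigidityMinimiserShells.SepReductionAssembly
  (le_dist_equivFin)
open Summit.AtomisticToContinuum.Crystallization.Theorems.PalmUnimodularRigidityMinimiserShells.ThresholdTransfer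
  (affine_of_threshold)
open Summit.AtomisticToContinuum.Crystallization.Theorems.LayeredLawsSelectHcp.Negative.FccModel
  (set_eq_of_count_restrict_eq)

/-! ## Locality of the loose shell predicate at deep sites -/

/-- **Deep sites see the same loose shell in `S` and in the window.**  For `θ ≥ 0`, if `C ⊆ S` contains
every point of `S` within distance `R₀ ≥ 5/4` of `y`, then `y` is `θ`-loosely well shelled in `S` iff it is
`θ`-loosely well shelled in `C` (re-rooted counting measures `count|((· - y) '' ·)`; locality of the loose
predicate, `NecessityBlocks.looseGood_congr_of_local`). -/
theorem looseGoodShell_count_restrict_image_sub_congr {θ : ℝ} (hθ : 0 ≤ θ) {S C : Set E3} (hCS : C ⊆ S)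
    {y : E3} {R₀ : ℝ} (hR₀ : 5 / 4 ≤ R₀) (hdeep : S ∩ Metric.closedBall y R₀ ⊆ C) :
    LooseGoodShell θ ((Measure.count : Measure E3).restrict ((fun z => z - y) '' S)) ↔
      LooseGoodShell θ ((Measure.count : Measure E3).restrict ((fun z => z - y) '' C)) :=
  NecessityBlocks.congr_count_restrict_image_sub_of_local (G := LooseGoodShell θ)
    (fun h => NecessityBlocks.looseGood_congr_of_local hθ h) hCS hR₀ hdeep

/-- **Deep loosely-bad sites inject into the loosely-bad indices of an enumeration** (loose analogue of
`ShellNoBoundary.card_le_natCard_bad`).  If `y : Fin N → ℝ³` has range `C ⊆ S` and every site of `G ⊆ C`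
is `θ`-loosely badly shelled in `S` and `R₀`-deep in `C` (`R₀ ≥ 5/4`, `θ ≥ 0`), then `#G` is at most the
number of indices `i` that are `θ`-loosely badly shelled in the finite configuration `y`. -/
theorem card_le_natCard_looseBad {θ : ℝ} (hθ : 0 ≤ θ) {S : Set E3} {C G : Finset E3} (hCS : ↑C ⊆ S)
    {R₀ : ℝ} (hR₀ : 5 / 4 ≤ R₀) (hGC : G ⊆ C)
    (hG : ∀ y ∈ G, ¬ LooseGoodShell θ ((Measure.count : Measure E3).restrict ((fun z => z - y) '' S)) ∧
      S ∩ Metric.closedBall y R₀ ⊆ ↑C)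
    {N : ℕ} {y : Fin N → E3} (hrange : Set.range y = ↑C) :
    G.card ≤ Nat.card {i : Fin N // ¬ LooseGoodShell θ
      ((Measure.count : Measure E3).restrict ((fun z => z - y i) '' Set.range y))} := by
  -- adapted from `ShellNoBoundary.card_le_natCard_bad` (θ = 0)
  have hmem : ∀ g : G, ∃ i : Fin N, y i = (g : E3) := fun g =>
    Set.mem_range.1 (by rw [hrange]; exact Finset.mem_coe.2 (hGC g.2))
  choose idx hidx using hmem
  have hbad : ∀ g : G, ¬ LooseGoodShell θ
      ((Measure.count : Measure E3).restrict ((fun z => z - y (idx g)) '' Set.range y)) := by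
    intro g
    rw [hidx g, hrange]
    exact fun hgood =>
      (hG g g.2).1 ((looseGoodShell_count_restrict_image_sub_congr hθ hCS hR₀ (hG g g.2).2).2 hgood)
  rw [← Nat.card_eq_finsetCard G]
  refine Nat.card_le_card_of_injective (fun g : G => (⟨idx g, hbad g⟩ : {i : Fin N // ¬ LooseGoodShell θ
      ((Measure.count : Measure E3).restrict ((fun z => z - y i) '' Set.range y))})) ?_
  intro g g' h
  have hi : idx g = idx g' := congrArg Subtype.val h
  exact Subtype.ext (calc (g : E3) = y (idx g) := (hidx g).symm
    _ = y (idx g') := by rw [hi]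
    _ = g' := hidx g')

/-! ## The finite loose gap prices deep loosely-bad sites on windows of `1/3`-separated sets -/

/-- **Threshold pricing from the `1/3`-separated finite loose gap** (S11 at the loose predicate).  If every
finite injective `1/3`-separated configuration with at least `t·N` `θ`-loosely-bad indices has
`N·(e* + κ) ≤ 𝓔_N`, then every finite window `C ⊆ S` of a `1/3`-separated `S` whose `R₀`-deep
(`R₀ ≥ 5/4`) sites `θ`-loosely badly shelled in `S` number at least `t·#C` has `#C·(e* + κ) ≤ ½ΣΣ_C V`
(canonical enumeration of `C`: injective, `1/3`-separated, energy `½ΣΣ_C V`, and `card_le_natCard_looseBad`). -/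
theorem thresholdPricing_of_sepLooseGap {θ : ℝ} (hθ : 0 ≤ θ) {t κ : ℝ}
    (hgapt : ∀ (N : ℕ) (y : Fin N → E3), Function.Injective y →
      (∀ i j : Fin N, i ≠ j → (1 : ℝ) / 3 ≤ dist (y i) (y j)) →
      t * (N : ℝ) ≤ (Nat.card {i : Fin N // ¬ LooseGoodShell θ
          ((Measure.count : Measure E3).restrict ((fun z => z - y i) '' Set.range y))} : ℝ) →
      (N : ℝ) * (eStar + κ) ≤ interactionEnergy lennardJones y)
    {S : Set E3} (hsep : ∀ x ∈ S, ∀ z ∈ S, x ≠ z → (1 : ℝ) / 3 ≤ dist x z)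
    {C : Finset E3} (hCS : (↑C : Set E3) ⊆ S) {R₀ : ℝ} (hR₀ : 5 / 4 ≤ R₀) {G : Finset E3} (hGC : G ⊆ C)
    (hG : ∀ y ∈ G, ¬ LooseGoodShell θ ((Measure.count : Measure E3).restrict ((fun z => z - y) '' S)) ∧
      S ∩ Metric.closedBall y R₀ ⊆ ↑C)
    (hthr : t * (C.card : ℝ) ≤ (G.card : ℝ)) :
    (C.card : ℝ) * (eStar + κ) ≤ (∑ x ∈ C, ∑ z ∈ C, lennardJones (dist x z)) / 2 := by
  have h2 := two_mul_interactionEnergy_equivFin C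
  have hle : (G.card : ℝ) ≤ (Nat.card {i : Fin C.card // ¬ LooseGoodShell θ
      ((Measure.count : Measure E3).restrict ((fun z => z - ((C.equivFin.symm i : C) : E3)) ''
        Set.range (fun i => ((C.equivFin.symm i : C) : E3))))} : ℝ) := by
    exact_mod_cast card_le_natCard_looseBad hθ hCS hR₀ hGC hG (range_equivFin_symm_val C)
  have hsepC : ∀ x ∈ C, ∀ z ∈ C, x ≠ z → (1 : ℝ) / 3 ≤ dist x z := fun x hx z hz hxz =>
    hsep x (hCS hx) z (hCS hz) hxz
  have hE := hgapt C.card (fun i => ((C.equivFin.symm i : C) : E3)) (equivFin_symm_val_injective C)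
    (le_dist_equivFin hsepC) (hthr.trans hle)
  linarith

/-! ## The stub -/

/-- **Stub 4 `stub_aeLooseGoodShell` of line `elastic-coarse-to-fine` (r5) — a.s. loosely good root shell**
(S11 + S8b at the loosened predicate): for `θ ≥ 0`, if the `θ`-loosely-good event is measurable modulo the
hard core and the loosened hard-core finite no-boundary gap holds, then every minimising point-stationary
hard-core probability law has almost surely a `θ`-loosely good root shell.  The transfer runs on the a.s. class
of `1/3`-separated e*-`μ`GSC configurations (`EquilibriumInLaw.stub_equilibriumInLaw`, `EnergyFloor.stub_energyFloor`,
uniform hard core `VolumeGrowth.Basics.le_dist`), prices deep loosely-bad sites on windows by the finite gap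
(`thresholdPricing_of_sepLooseGap`, `ThresholdTransfer.affine_of_threshold`) and concludes by the slack event
transfer `SlackEventTransfer.stub_slackEventTransfer` (`P(bad) ≤ t` for every `t > 0`). -/
theorem stub_aeLooseGoodShell :
    ∀ θ : ℝ, 0 ≤ θ →
      (∃ B : Set (Measure (EuclideanSpace ℝ (Fin 3))), MeasurableSet B ∧
        ∀ δ : ℝ, 0 < δ → ∀ μ : Measure (EuclideanSpace ℝ (Fin 3)), IsRootedHardCore δ μ →
          (μ ∈ B ↔ LooseGoodShell θ μ)) →
      (∀ t : ℝ, 0 < t → ∃ κ : ℝ, 0 < κ ∧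
        ∀ (N : ℕ) (y : Fin N → EuclideanSpace ℝ (Fin 3)), Function.Injective y →
          (∀ i j : Fin N, i ≠ j → (1 : ℝ) / 3 ≤ dist (y i) (y j)) →
          t * (N : ℝ) ≤ (Nat.card {i : Fin N // ¬ LooseGoodShell θ
              ((Measure.count : Measure (EuclideanSpace ℝ (Fin 3))).restrict
                ((fun z => z - y i) '' Set.range y))} : ℝ) →
          (N : ℝ) * (eStar + κ) ≤ interactionEnergy lennardJones y) →
      ∀ δ : ℝ, 0 < δ → ∀ P : Measure (Measure (EuclideanSpace ℝ (Fin 3))), IsProbabilityMeasure P →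
        (∀ᵐ μ ∂P, IsRootedHardCore δ μ) → IsPointStationaryLaw P → meanRootEnergy P ≤ eStar →
        ∀ᵐ μ ∂P, LooseGoodShell θ μ := by
  intro θ hθ hB hgap δ hδ P hP hcore hstat hE
  obtain ⟨B, hBm, hB⟩ := hB
  haveI := hP
  -- the a.s. class: `1/3`-separated e*-μGSC configurations
  have hK : ∀ᵐ μ ∂P, ∃ S : Set E3, μ = (Measure.count : Measure E3).restrict S ∧
      (IsMuGSC lennardJones eStar S ∧ ∀ x ∈ S, ∀ z ∈ S, x ≠ z → (1 : ℝ) / 3 ≤ dist x z) := by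
    filter_upwards [EquilibriumInLaw.stub_equilibriumInLaw EnergyFloor.stub_energyFloor δ hδ P hP hcore hstat hE,
      hcore] with μ hμ hhc
    obtain ⟨S', hS', hgsc⟩ := hμ
    obtain ⟨S, -, hsep, rfl⟩ := hhc
    obtain rfl : S = S' := set_eq_of_count_restrict_eq hS'
    exact ⟨S, rfl, hgsc, VolumeGrowth.Basics.le_dist (⟨δ, hδ, hsep⟩ : UniformlyDiscrete S) hgsc⟩
  -- the loosely-bad event `Bᶜ` has probability `≤ t` for every `t > 0`
  have hle : ∀ t : ℝ, 0 < t → P Bᶜ ≤ ENNReal.ofReal t := by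
    intro t ht
    obtain ⟨κ, hκ, hgapt⟩ := hgap t ht
    have h := SlackEventTransfer.stub_slackEventTransfer δ hδ P hP hcore hstat hE
      (fun S => IsMuGSC lennardJones eStar S ∧ ∀ x ∈ S, ∀ z ∈ S, x ≠ z → (1 : ℝ) / 3 ≤ dist x z) hK
      Bᶜ hBm.compl 1 2 κ (κ * t) one_pos two_pos hκ (by positivity) ?_
    · rwa [mul_div_cancel_left₀ _ hκ.ne'] at h
    intro S hsep hKS L _ a C hC G hGC hG
    have hCS : (↑C : Set E3) ⊆ S := hC ▸ Set.inter_subset_left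
    have hG' : ∀ y ∈ G, ¬ LooseGoodShell θ ((Measure.count : Measure E3).restrict ((fun z => z - y) '' S)) ∧
        S ∩ Metric.closedBall y 2 ⊆ ↑C := by
      intro y hy
      obtain ⟨hyB, hdeep⟩ := hG y hy
      refine ⟨fun hgood => hyB ?_, hdeep⟩
      have hyS : y ∈ S := hCS (hGC hy)
      have hhc : IsRootedHardCore δ ((Measure.count : Measure E3).restrict ((fun z => z - y) '' S)) :=
        ⟨(fun z => z - y) '' S, ⟨y, hyS, sub_self y⟩, sep_image_sub hsep y, rfl⟩
      exact (hB δ hδ _ hhc).2 hgood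
    have haff := affine_of_threshold ht.le hκ hGC
      (thresholdPricing_of_sepLooseGap hθ hgapt hKS.2 hCS (by norm_num : (5 : ℝ) / 4 ≤ 2) hGC hG')
    linarith
  -- hence it is null
  have hnull : P Bᶜ = 0 := by
    by_contra hne
    have hPtop : P Bᶜ ≠ ∞ := measure_ne_top P Bᶜ
    have hp0 : 0 < (P Bᶜ).toReal := ENNReal.toReal_pos hne hPtop
    have h := hle ((P Bᶜ).toReal / 2) (by positivity)
    have : P Bᶜ < P Bᶜ :=
      calc P Bᶜ ≤ ENNReal.ofReal ((P Bᶜ).toReal / 2) := h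
        _ < ENNReal.ofReal (P Bᶜ).toReal := (ENNReal.ofReal_lt_ofReal_iff hp0).2 (by linarith)
        _ = P Bᶜ := ENNReal.ofReal_toReal hPtop
    exact lt_irrefl _ this
  have hae : ∀ᵐ μ ∂P, μ ∈ B := by
    rw [ae_iff]
    simpa only [Set.compl_def] using hnull
  filter_upwards [hcore, hae] with μ hμ hμB
  exact (hB δ hδ μ hμ).1 hμB

end Summit.AtomisticToContinuum.Crystallization.Theorems.PalmUnimodularRigidityMinimiserShells.AeLooseGoodShell

end
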